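import Literature.NumberTheory.EllipticCurves.ZpExtensionEisensteinTwistedFilCoordinatesProofs
import Literature.NumberTheory.EllipticCurves.ZpExtensionEisensteinOrdinaryFilTransferProofs
import Literature.NumberTheory.EllipticCurves.TorsionFilAtAdaptedBasisProofs
import HarnessLib

/-!
# (ONTO) and (SAT) for the twisted plus parts of the Eisenstein tower at a place above `p` (theorems only)

`Proofs` file (theorems only; no definition, no named fact, no instance, no `sorry`).  Topic `NumberTheory/EllipticCurves`
(cell `pub/bsd-print-x9`; the two binders `honto` / `hsat` of x10b-p1-w8's `ZpExtensionEisensteinOrdinaryResidualStrictProofs`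
(the residual STRICT readout of Howard's `F_𝔮` at `w ∣ p`, ruling (R1) of LEAD g8 2026-08-28) — x9-p1-w3's share (V2/V3 module facts)).

For the Eisenstein tower `W_j = M_j ⊗ A_{m,j}(ψ)` with two-index family `F a b = ZpExtension.eisensteinTwistTransfer` and the twisted
plus parts `Fil_w W_j = A_{m,j} ⊗ Fil_w M_j` (`OrdinaryFiltration.twistedFil`) of an ordinary datum `Φ` at `w`:
* §2 (the tree's `EisensteinCoeff.exists_eq_pow_mul_of_pow_mul_eq_zero`: in `A_{m,ℓ+n}`, `p^n c = 0 ⇒ c ∈ p^ℓ A`)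
  `Twisted.exists_mem_add_pow_smul_of_pow_smul_mem'` — with a basis of `M_{ℓ+n}` adapted to `Fil`:
  `p^n y ∈ Fil_w W_{ℓ+n} ⇒ y ∈ Fil_w W_{ℓ+n} + p^ℓ W_{ℓ+n}`;
* §3 **(ONTO) `OrdinaryFiltration.exists_mem_twistedFil_transfer_eq`** — the reductions are ONTO on the plus parts
  (`F (ℓ+n) n (Fil_w W_{ℓ+n}) = Fil_w W_n`) as soon as the transitions `t_k` are onto on `Fil_w M_k` (`hFsurj`);
  **(SAT) `OrdinaryFiltration.mem_twistedFil_of_transfer_mem`** — `F ℓ (ℓ+n) x ∈ Fil_w W_{ℓ+n} ⇒ x ∈ Fil_w W_ℓ` given an adapted basis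
  of `M_{ℓ+n}` (`Fil_w M_{ℓ+n}` a rank-one direct summand);
* §4 for the curve at a place `w ∋ p` of good reduction with an ordinary point (`ordinaryFiltrationAt`; adapted bases from
  `TorsionFilAtAdaptedBasisProofs`, `hFsurj` from `ZpExtensionEisensteinOrdinaryFilTransferProofs`):
  **`WeierstrassCurve.exists_mem_twistedFil_transfer_eq_ordinaryFiltrationAt`** (= `honto`) and
  **`WeierstrassCurve.mem_twistedFil_of_transfer_mem_ordinaryFiltrationAt`** (= `hsat`), verbatim in the binder shapes.
No summit statement is proved; BSD is not proved by any of this.  Seat `bsd-line-x9-p1-w3` g5.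

References: [Howard2004HeegnerKolyvagin] H.0, Rem. 1.1.4, Def. 1.1.3, §3.1 (arXiv:1202.6340 p. 5, p. 7, p. 15 L56–62);
[GreenbergLNM1716] §2; [BourbakiAlgebre1a3] Ch. II §5 no. 1 Prop. 4.
-/

set_option autoImplicit false

noncomputable section

open Function Field

namespace Literature.NumberTheory.EllipticCurves

/-! ## §2 With an adapted basis: `p^n y ∈ F ⇒ y ∈ F + p^ℓ W` at level `ℓ + n` -/

namespace IwasawaAlgebra.EisensteinCoeff.Twisted

open IwasawaAlgebra IwasawaAlgebra.EisensteinCoeff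

variable {p : ℕ} [hp : Fact p.Prime] {m j : ℕ} {M : Type} [AddCommGroup M]
  (e : M ≃+ (Fin 2 → ZMod (p ^ j))) (Fil : AddSubgroup M) (he : ∀ x : M, x ∈ Fil ↔ e x 1 = 0)

include he in
/-- **`p^n y ∈ F ⇒ y ∈ F + p^ℓ W`** at level `j = ℓ + n ≥ 1`, for the twisted plus part `F = span {c ⊗ x : x ∈ Fil}` and a basis of
`M` adapted to `Fil`: the coordinate `(b.repr y)₁` is killed by `p^n`, hence divisible by `p^ℓ` (§1).
[cite: Howard2004HeegnerKolyvagin, H.0, Rem. 1.1.4 and §3.1 (arXiv p. 5, p. 7, p. 15)] [cite: GreenbergLNM1716, §2] -/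
theorem exists_mem_add_pow_smul_of_pow_smul_mem' (hm : 1 ≤ m) {ℓ n : ℕ} (hj : j = ℓ + n) (hj1 : 1 ≤ j) (y : Twisted p m j M)
    (hy : (p ^ n) • y ∈ Submodule.span ℤ
      {x : Twisted p m j M | ∃ (c : EisensteinCoeff p m j) (a : M), a ∈ Fil ∧ x = Twisted.tmul c a}) :
    ∃ φ ∈ Submodule.span ℤ {x : Twisted p m j M | ∃ (c : EisensteinCoeff p m j) (a : M), a ∈ Fil ∧ x = Twisted.tmul c a},
      ∃ y' : Twisted p m j M, y = φ + (p ^ ℓ) • y' := by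
  subst hj
  set b := Twisted.basisOfAddEquiv (m := m) e with hb
  have h1 : ((p : ℕ) : EisensteinCoeff p m (ℓ + n)) ^ n * b.repr y 1 = 0 := by
    have h := (mem_twistedSpan_iff_repr_one_eq_zero e Fil he _).mp hy
    rwa [← Nat.cast_smul_eq_nsmul (EisensteinCoeff p m (ℓ + n)), map_smul, Finsupp.smul_apply, smul_eq_mul,
      Nat.cast_pow] at h
  obtain ⟨c', hc'⟩ := EisensteinCoeff.exists_eq_pow_mul_of_pow_mul_eq_zero hm (Nat.le_add_left n ℓ) _ h1
  rw [Nat.add_sub_cancel] at hc'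
  have hsum := b.sum_repr y
  rw [Fin.sum_univ_two] at hsum
  refine ⟨b.repr y 0 • b 0, ?_, c' • b 1, ?_⟩
  · refine (mem_twistedSpan_iff_repr_one_eq_zero e Fil he _).mpr ?_
    rw [map_smul, Finsupp.smul_apply, b.repr_self, Finsupp.single_apply, if_neg zero_ne_one, smul_zero]
  · have hpa : (((p : ℕ) : EisensteinCoeff p m (ℓ + n)) ^ ℓ) • (c' • b 1) = (p ^ ℓ) • (c' • b 1) := by
      rw [← Nat.cast_smul_eq_nsmul (EisensteinCoeff p m (ℓ + n)) (p ^ ℓ), Nat.cast_pow]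
    conv_lhs => rw [← hsum]
    rw [hc', mul_smul, hpa]

end IwasawaAlgebra.EisensteinCoeff.Twisted

/-! ## §3 (ONTO) and (SAT) for a general tower -/

namespace ZpExtension

open scoped TensorProduct ContRepresentation
open Literature.NumberTheory.GaloisRepresentations IwasawaAlgebra IsDedekindDomain
open scoped NumberField

variable {K : Type} [Field K] [NumberField K] {p : ℕ} [hp : Fact p.Prime] (κ : ZpExtension K p)
  {M : ℕ → Type} [∀ k, AddCommGroup (M k)] [∀ k, TopologicalSpace (M k)] [∀ k, DiscreteTopology (M k)]
  (ρ : ∀ k, DiscreteGaloisModule K (M k))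
  (t : ∀ k, (ρ (k + 1)).toContRepresentation →ⁱL (ρ k).toContRepresentation)
  {m : ℕ} (hm : 1 ≤ m) (ht : ∀ k, Function.Surjective (t k))
  (hkt : ∀ k (x : M (k + 1)), t k x = 0 ↔ ∃ y : M (k + 1), x = ((p : ℤ) ^ k) • y)
  (hkill : ∀ k (x : M k), ((p : ℤ) ^ k) • x = 0)
  {v : HeightOneSpectrum (𝓞 K)} (Φ : OrdinaryFiltration ρ t v)

/-- **(ONTO) The reductions are onto on the twisted plus parts**: every `x' ∈ Fil_v W_n` is `F (ℓ+n) n x` for some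
`x ∈ Fil_v W_{ℓ+n}`, as soon as the transitions are onto on `Fil_v M_k` (generators `c ⊗ a` lift to `c̃ ⊗ a'` with `c̃ ↦ c`,
`t^ℓ a' = a`; sums and integer multiples lift). [cite: Howard2004HeegnerKolyvagin, §3.1 (arXiv p. 15, L56–62)] [cite: GreenbergLNM1716, §2 p. 82] -/
theorem OrdinaryFiltration.exists_mem_twistedFil_transfer_eq
    (hFsurj : ∀ (k : ℕ) (y : M k), y ∈ Φ.fil k → ∃ y' ∈ Φ.fil (k + 1), t k y' = y) (ℓ n : ℕ)
    (x' : EisensteinCoeff.Twisted p m n (M n)) (hx' : x' ∈ Φ.twistedFil (p := p) (m := m) n) :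
    ∃ x ∈ Φ.twistedFil (p := p) (m := m) (ℓ + n), κ.eisensteinTwistTransfer ρ t hm ht hkt hkill (ℓ + n) n x = x' := by
  have hle : n ≤ ℓ + n := Nat.le_add_left n ℓ
  have hred : ∀ (c : EisensteinCoeff p m (ℓ + n)) (y : M (ℓ + n)),
      κ.eisensteinTwistTransfer ρ t hm ht hkt hkill (ℓ + n) n (EisensteinCoeff.Twisted.tmul c y) =
        EisensteinCoeff.Twisted.tmul (EisensteinCoeff.reduce p m hle c) (transitionIter ρ t hle y) := by
    intro c y
    rw [κ.eisensteinTwistTransfer_of_le ρ t hm ht hkt hkill hle]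
    exact κ.eisensteinTwistReduce_tmul hm hle (transitionIter ρ t hle) c y
  induction hx' using Submodule.span_induction with
  | mem y hy =>
    obtain ⟨c, a, ha, rfl⟩ := hy
    obtain ⟨a', ha', haa⟩ := exists_mem_fil_transitionIter_eq ρ t Φ hFsurj hle a ha
    obtain ⟨c', rfl⟩ := EisensteinCoeff.reduce_surjective (p := p) m hle c
    exact ⟨EisensteinCoeff.Twisted.tmul c' a', Φ.tmul_mem_twistedFil (ℓ + n) c' ha', by rw [hred, haa]⟩
  | zero => exact ⟨0, Submodule.zero_mem _, map_zero _⟩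
  | add y z _ _ hy hz =>
    obtain ⟨y₁, hy₁, rfl⟩ := hy
    obtain ⟨z₁, hz₁, rfl⟩ := hz
    exact ⟨y₁ + z₁, Submodule.add_mem _ hy₁ hz₁, map_add _ _ _⟩
  | smul k y _ hy =>
    obtain ⟨y₁, hy₁, rfl⟩ := hy
    exact ⟨k • y₁, Submodule.smul_mem _ k hy₁, map_zsmul _ k _⟩

/-- **(SAT) The twisted plus parts are saturated in the tower**: `F ℓ (ℓ+n) x ∈ Fil_v W_{ℓ+n} ⇒ x ∈ Fil_v W_ℓ`, given a basis
of `M_{ℓ+n}` adapted to `Fil_v M_{ℓ+n}` (a rank-one direct summand): `x = red y`, `F(x) = p^n y ∈ Fil`, so `y ∈ Fil + p^ℓ W`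
(§2) and `x = red φ` (`p^ℓ` kills `W_ℓ`). [cite: Howard2004HeegnerKolyvagin, H.0, Def. 1.1.3 and §3.1 (arXiv p. 5, p. 7, p. 15)]
[cite: GreenbergLNM1716, §2] -/
theorem OrdinaryFiltration.mem_twistedFil_of_transfer_mem (ℓ n : ℕ)
    (hbasis : 1 ≤ ℓ + n → ∃ e : M (ℓ + n) ≃+ (Fin 2 → ZMod (p ^ (ℓ + n))), ∀ x, x ∈ Φ.fil (ℓ + n) ↔ e x 1 = 0)
    (x : EisensteinCoeff.Twisted p m ℓ (M ℓ))
    (hx : κ.eisensteinTwistTransfer ρ t hm ht hkt hkill ℓ (ℓ + n) x ∈ Φ.twistedFil (p := p) (m := m) (ℓ + n)) :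
    x ∈ Φ.twistedFil (p := p) (m := m) ℓ := by
  rcases Nat.eq_zero_or_pos (ℓ + n) with h0 | hpos
  · -- `ℓ = n = 0`: `F 0 0 = id`
    obtain ⟨rfl, rfl⟩ : ℓ = 0 ∧ n = 0 := by omega
    have hself : κ.eisensteinTwistTransfer ρ t hm ht hkt hkill (0 + 0) (0 + 0) x = x :=
      κ.eisensteinTwistTransfer_self ρ t hm ht hkt hkill 0 x
    rw [hself] at hx
    exact hx
  obtain ⟨e, he⟩ := hbasis hpos
  have hle : ℓ ≤ ℓ + n := Nat.le_add_right ℓ n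
  obtain ⟨y, rfl⟩ := κ.eisensteinTwistTransfer_surjective_of_le ρ t hm ht hkt hkill hle x
  rw [κ.eisensteinTwistTransfer_apply_apply_of_le ρ t hm ht hkt hkill ℓ n y] at hx
  obtain ⟨φ, hφ, y', rfl⟩ := EisensteinCoeff.Twisted.exists_mem_add_pow_smul_of_pow_smul_mem' e (Φ.fil (ℓ + n)).toAddSubgroup
    (fun x ↦ he x) hm rfl hpos y hx
  rw [map_add, map_nsmul]
  have hkill' : (p ^ ℓ) • κ.eisensteinTwistTransfer ρ t hm ht hkt hkill (ℓ + n) ℓ y' = 0 := by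
    rw [← natCast_zsmul, Nat.cast_pow]
    exact EisensteinCoeff.natCast_pow_smul_eq_zero m ℓ _
  rw [hkill', add_zero]
  exact κ.eisensteinTwistTransfer_mem_twistedFil_of_le ρ t hm ht hkt hkill Φ hle hφ

end ZpExtension

end Literature.NumberTheory.EllipticCurves

/-! ## §4 The curve at a place above `p` -/

namespace WeierstrassCurve

open Literature.NumberTheory.EllipticCurves Literature.NumberTheory.GaloisRepresentations
open Literature.NumberTheory.EllipticCurves.IwasawaAlgebra IsDedekindDomain
open scoped NumberField ContRepresentation

variable {K : Type} [Field K] [NumberField K] (W : WeierstrassCurve K) [W.IsElliptic] {p : ℕ} [hp : Fact p.Prime]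
  (v : HeightOneSpectrum (𝓞 K)) (κ : ZpExtension K p) {m : ℕ} (hm : 1 ≤ m)
  (t : ∀ k, (W.torsionGaloisModule ((p : ℤ) ^ (k + 1))).toContRepresentation →ⁱL
    (W.torsionGaloisModule ((p : ℤ) ^ k)).toContRepresentation)
  (ht : ∀ k (P : geomTorsion W ((p : ℤ) ^ (k + 1))), t k P = W.geomTorsionReduce p k P)

set_option maxHeartbeats 800000 in
/-- **(ONTO) for the curve's Eisenstein tower at a place `v ∋ p` of good reduction with an ordinary point** — the binder
`honto` of `ZpExtension.propagate_eisensteinSelmerStructure_one_eq_strictSubgroup` for `ordinaryFiltrationAt`.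
[cite: Howard2004HeegnerKolyvagin, §3.1 (arXiv p. 15, L56–62)] [cite: GreenbergLNM1716, §2 p. 82] -/
theorem exists_mem_twistedFil_transfer_eq_ordinaryFiltrationAt (hgood : W.HasGoodReductionAt v) (hpv : (p : 𝓞 K) ∈ v.asIdeal)
    (hord : ∃ P : localPoints W (v.adicCompletion K), (p : ℤ) • P = 0 ∧ P ∉ W.localKernelOfReduction v) (ℓ n : ℕ)
    (x' : EisensteinCoeff.Twisted p m n (geomTorsion W ((p : ℤ) ^ n)))
    (hx' : x' ∈ (W.ordinaryFiltrationAt v t ht).twistedFil (p := p) (m := m) n) :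
    ∃ x ∈ (W.ordinaryFiltrationAt v t ht).twistedFil (p := p) (m := m) (ℓ + n),
      κ.eisensteinTwistTransfer (fun k ↦ W.torsionGaloisModule ((p : ℤ) ^ k)) t hm
        (W.torsionGaloisModule_transition_hypotheses t (fun k P ↦ by rw [ht]; rfl)).1
        (W.torsionGaloisModule_transition_hypotheses t (fun k P ↦ by rw [ht]; rfl)).2.1
        (W.torsionGaloisModule_transition_hypotheses t (fun k P ↦ by rw [ht]; rfl)).2.2 (ℓ + n) n x = x' :=
  ZpExtension.OrdinaryFiltration.exists_mem_twistedFil_transfer_eq κ (fun k ↦ W.torsionGaloisModule ((p : ℤ) ^ k)) t hm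
    (W.torsionGaloisModule_transition_hypotheses t (fun k P ↦ by rw [ht]; rfl)).1
    (W.torsionGaloisModule_transition_hypotheses t (fun k P ↦ by rw [ht]; rfl)).2.1
    (W.torsionGaloisModule_transition_hypotheses t (fun k P ↦ by rw [ht]; rfl)).2.2 (W.ordinaryFiltrationAt v t ht)
    (fun k y hy ↦ W.exists_mem_torsionFilAt_reduce_eq v hgood hpv hord t ht k y hy) ℓ n x' hx'

set_option maxHeartbeats 800000 in
/-- **(SAT) for the curve's Eisenstein tower at a place `v ∋ p` of good reduction with an ordinary point** — the binder
`hsat` of `ZpExtension.propagate_eisensteinSelmerStructure_one_eq_strictSubgroup` for `ordinaryFiltrationAt` (`Fil_v E[p^j]` is a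
rank-one direct summand: `TorsionFilAtAdaptedBasisProofs`). [cite: Howard2004HeegnerKolyvagin, H.0 and §3.1 (arXiv p. 7 L57, p. 15 L56–62)]
[cite: GreenbergLNM1716, §2] -/
theorem mem_twistedFil_of_transfer_mem_ordinaryFiltrationAt (hgood : W.HasGoodReductionAt v) (hpv : (p : 𝓞 K) ∈ v.asIdeal)
    (hord : ∃ P : localPoints W (v.adicCompletion K), (p : ℤ) • P = 0 ∧ P ∉ W.localKernelOfReduction v) (ℓ n : ℕ)
    (x : EisensteinCoeff.Twisted p m ℓ (geomTorsion W ((p : ℤ) ^ ℓ)))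
    (hx : κ.eisensteinTwistTransfer (fun k ↦ W.torsionGaloisModule ((p : ℤ) ^ k)) t hm
        (W.torsionGaloisModule_transition_hypotheses t (fun k P ↦ by rw [ht]; rfl)).1
        (W.torsionGaloisModule_transition_hypotheses t (fun k P ↦ by rw [ht]; rfl)).2.1
        (W.torsionGaloisModule_transition_hypotheses t (fun k P ↦ by rw [ht]; rfl)).2.2 ℓ (ℓ + n) x ∈
      (W.ordinaryFiltrationAt v t ht).twistedFil (p := p) (m := m) (ℓ + n)) :
    x ∈ (W.ordinaryFiltrationAt v t ht).twistedFil (p := p) (m := m) ℓ :=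
  ZpExtension.OrdinaryFiltration.mem_twistedFil_of_transfer_mem κ (fun k ↦ W.torsionGaloisModule ((p : ℤ) ^ k)) t hm
    (W.torsionGaloisModule_transition_hypotheses t (fun k P ↦ by rw [ht]; rfl)).1
    (W.torsionGaloisModule_transition_hypotheses t (fun k P ↦ by rw [ht]; rfl)).2.1
    (W.torsionGaloisModule_transition_hypotheses t (fun k P ↦ by rw [ht]; rfl)).2.2 (W.ordinaryFiltrationAt v t ht) ℓ n
    (fun h ↦ W.exists_addEquiv_mem_torsionFilAt_iff v hgood hpv hord h) x hx

end WeierstrassCurve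

end
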